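import Summits.QuantumFields.QCD.Theses.EulerDescent
import Summits.QuantumFields.QCD.Theorems.EulerDescentHonestHeavyAnchorSplit
import Summits.QuantumFields.QCD.Theorems.RobustYangMillsHandover.Negative.ChiralityObstruction
import Summits.QuantumFields.QCD.Theorems.RayDescent.Negative.TrivialSlices

/-!
# Crux `ChiralCornerSoftness` (stmt-QuantumFields-16902, route `EulerDescent`) — negative side:
# which hypotheses are load-bearing (cdisprove seat, cycle 1)

The crux: `∀ N_f ∈ {2,3}, ∀ reg mc, Corner reg mc → Pin reg mc → reg.HasMassScaling → AS reg → Branch reg →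
reg.IsChiralAtZero` (`Summit.QuantumFields.QCD.Theses.EulerDescent.ChiralCornerSoftness`; `Crux` below is it,
definitionally, `crux_iff`).  No unconditional `¬`-theorem about it or its mutilations can be written in the present
tree: `not_chiralCornerSoftness_iff` shows `¬ crux` is LITERALLY an honestly pinned regularisation with ONE lattice
rate at ALL positive tuples, i.e. a light-quark lattice mass gap theorem, and every hypothesis is a clause about the
honest `qcdLatticeConnectedCorr`.  What IS kernel-checkable is the load-bearing structure MODULO named lattice-gap
hypotheses `H` (each a precise `Prop` about honest lattice QCD that the tree cannot construct; each witness an explicit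
structure update of the regularisation `H` provides):

* `withoutPin_false_of_gappedAnchor` — drop the PIN ⇒ false; witness: the `m_crit`-shift `m_crit + a M_h/Z_m` of a
  corner-carrying scaling regularisation uniformly gapped above `M_h` (`GappedAnchor` = `HonestHeavyAnchor`'s lattice
  clause with one rate).  Any proof must use the pin.
* `withoutCorner_false_of_gappedScalingReg` — drop the CORNER (pin to an arbitrary `mc`) ⇒ false; same witness pinned
  to its own `m_crit`.  The pin is only as good as the set it pins to.
* `withoutMassScaling_false_of_tupleUniformGap` — drop `HasMassScaling` ⇒ false; witness `Z_m ↦ Z_m/(k+1)` of an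
  honestly pinned regularisation with a tuple-uniform heavy gap: the pin survives (× `1/(k+1)`), every positive tuple is
  driven to renormalised mass `(k+1)·m → ∞`.  Mass scaling is what keeps `∀ m > 0` a light-quark family.
* `withoutAsymptoticScaling_false_of_hardConstantCouplingCorner` — drop AS ⇒ false; witness: constant coupling parked
  exactly at its own corner (hard in units of `a_k` in both Sharpe–Singleton scenarios).
* `tendsto_mcrit_sub_corner`, `branch_of_corner_pin_massScaling`, `chiralCornerSoftness_iff_withoutBranch` — the
  BRANCH hypothesis `∀ᶠ k, −1 < m_crit k` is redundant modulo "weak-coupling corners stay above `−1 + η`"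
  (`CornersAboveMinusOne`; physically `μ_c(β) → 0⁻`): information for the prover — its only role is Lüscher
  positivity in proofs.
* `corner_zero_unsat`, `uniformGap_rescale` — the closed junk escapes (`N_f = 0` slice vacuous; unit relabelings
  covariant), re-exported from `RayDescent.Negative.TrivialSlices` in this crux's currency.

Pure logic / real analysis over `QCDOS.lean` and the landed `RobustYangMillsHandover.Negative.ChiralityObstruction`,
`EulerDescentHonestHeavyAnchorSplit`, `RayDescent.Negative.TrivialSlices`; nothing here asserts a Theses decl
positively.  Workfile with the line-`Sketch` stub notes: `Cruxes/ChiralCornerSoftness/Disproof.lean`. [folklore]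
-/

noncomputable section

namespace Summit.QuantumFields.QCD.Theorems.ChiralCornerSoftness.Negative

open Filter Topology
open Literature.MathematicalPhysics.QuantumFieldTheory
open Summit.QuantumFields.QCD.Theses.EulerDescent (ChiralCornerSoftness)
open Summit.QuantumFields.QCD.Theorems

variable {Nf : ℕ}

/-! ## §1 Vocabulary (the crux's clauses, verbatim) -/

/-- The crux's corner clause: eventually `mc k` is the least upper bound of the non-massive degenerate bare masses at
`β_k` (verbatim). -/
def Corner (reg : QCDRegularisation Nf) (mc : ℕ → ℝ) : Prop :=
  ∀ᶠ k in atTop, IsLUB {μ : ℝ | ¬ (∀ (R R' : ℕ) (A : QCDLatticeObservable Nf R) (B : QCDLatticeObservable Nf R'),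
    ∃ (C δ : ℝ) (S₀ : ℕ), 0 < δ ∧ ∀ S : ℕ, S₀ ≤ S → ∀ n : ℕ, n ≤ S →
      ‖qcdLatticeConnectedCorr (reg.β k) (2 * S + 1) (fun _ : Fin Nf => μ) A B n‖ ≤ C * Real.exp (-(δ * n)))} (mc k)

/-- The pin `(m_crit − mc)·Z_m/a → 0` (verbatim). -/
def Pin (reg : QCDRegularisation Nf) (mc : ℕ → ℝ) : Prop :=
  Tendsto (fun k => (reg.mcrit k - mc k) * reg.Zm k / reg.a k) atTop (nhds 0)

/-- Two-loop asymptotic scaling of the regularisation (verbatim: read through the zero-mass scheme). -/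
def AS (reg : QCDRegularisation Nf) : Prop := (reg.scheme 0 0 0).HasAsymptoticScaling

/-- The physical branch `m_crit > −1` eventually (verbatim). -/
def Branch (reg : QCDRegularisation Nf) : Prop := ∀ᶠ k in atTop, (-1 : ℝ) < reg.mcrit k

/-- ONE lattice rate `ε` at ALL positive tuples (the negation of `IsChiralAtZero` at the rate `ε`). -/
def UniformGap (reg : QCDRegularisation Nf) (ε : ℝ) : Prop :=
  ∀ m : Fin Nf → ℝ, (∀ f, 0 < m f) → (reg.scheme m 0 0).HasLatticeMassGap ε

/-- The crux restated over the vocabulary (definitionally the route decl, `crux_iff`). -/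
def Crux : Prop :=
  ∀ Nf : ℕ, Nf = 2 ∨ Nf = 3 → ∀ (reg : QCDRegularisation Nf) (mc : ℕ → ℝ),
    Corner reg mc → Pin reg mc → reg.HasMassScaling → AS reg → Branch reg → reg.IsChiralAtZero

/-- `Crux` is the route decl, definitionally. [folklore] -/
theorem crux_iff : Crux ↔ ChiralCornerSoftness := Iff.rfl

/-! ## §2 Load-bearing analysis (each mutilated crux is false modulo a named lattice-gap hypothesis) -/

/-- ¬crux in canonical form: an honestly pinned regularisation with ONE rate at ALL positive tuples. [folklore] -/
theorem not_crux_iff :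
    ¬ Crux ↔ ∃ Nf : ℕ, (Nf = 2 ∨ Nf = 3) ∧ ∃ (reg : QCDRegularisation Nf) (mc : ℕ → ℝ),
      Corner reg mc ∧ Pin reg mc ∧ reg.HasMassScaling ∧ AS reg ∧ Branch reg ∧ ∃ ε > (0 : ℝ), UniformGap reg ε := by
  constructor
  · intro h
    by_contra hne
    apply h
    intro Nf hNf reg mc hc hp hms has hbr
    by_contra hchi
    obtain ⟨ε, hε, hgap⟩ :=
      (RobustYangMillsHandover.Negative.not_isChiralAtZero_iff_uniformLatticeGap reg).mp hchi
    exact hne ⟨Nf, hNf, reg, mc, hc, hp, hms, has, hbr, ε, hε, hgap⟩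
  · rintro ⟨Nf, hNf, reg, mc, hc, hp, hms, has, hbr, ε, hε, hgap⟩ h
    exact RobustYangMillsHandover.Negative.not_isChiralAtZero_of_uniformLatticeGap reg hε hgap
      (h Nf hNf reg mc hc hp hms has hbr)

/-- The same for the route decl by name. [folklore] -/
theorem not_chiralCornerSoftness_iff :
    ¬ ChiralCornerSoftness ↔ ∃ Nf : ℕ, (Nf = 2 ∨ Nf = 3) ∧ ∃ (reg : QCDRegularisation Nf) (mc : ℕ → ℝ),
      Corner reg mc ∧ Pin reg mc ∧ reg.HasMassScaling ∧ AS reg ∧ Branch reg ∧ ∃ ε > (0 : ℝ), UniformGap reg ε :=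
  not_crux_iff

/-! ### The PIN is load-bearing -/

/-- The crux with the PIN dropped. -/
def WithoutPin : Prop :=
  ∀ Nf : ℕ, Nf = 2 ∨ Nf = 3 → ∀ (reg : QCDRegularisation Nf) (mc : ℕ → ℝ),
    Corner reg mc → reg.HasMassScaling → AS reg → Branch reg → reg.IsChiralAtZero

/-- **H_anchor** (`HonestHeavyAnchor`'s lattice clause with ONE rate): a corner-carrying, mass-scaling, asymptotically
scaling regularisation on the physical branch that is uniformly gapped at every tuple above a threshold `M_h`.
Physically: the lightest state above the threshold is a glueball or a heavy meson, both `≥ ε`.  Not constructible in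
the tree (it contains a lattice mass gap of QCD with heavy quarks along an AF sequence). -/
def GappedAnchor (Nf : ℕ) : Prop :=
  ∃ (reg : QCDRegularisation Nf) (mc : ℕ → ℝ), Corner reg mc ∧ reg.HasMassScaling ∧ AS reg ∧ Branch reg ∧
    ∃ Mh : ℝ, 0 ≤ Mh ∧ ∃ ε > (0 : ℝ), ∀ m : Fin Nf → ℝ, (∀ f, Mh < m f) → (reg.scheme m 0 0).HasLatticeMassGap ε

/-- **Dropping the PIN is fatal (modulo H_anchor)**: the `m_crit`-shifted regularisation
`m_crit ↦ m_crit + a M_h/Z_m` keeps the corner (same `β`), mass scaling (same `Z_m`), asymptotic scaling (same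
`β, a`) and the branch (`m_crit` only grows), and is NOT chiral at zero (landed
`RobustYangMillsHandover.Negative.not_isChiralAtZero_mcrit_shift_of_uniformGapAbove`).  Any proof of the crux must
use the pin. [folklore] -/
theorem withoutPin_false_of_gappedAnchor (H : ∃ Nf : ℕ, (Nf = 2 ∨ Nf = 3) ∧ GappedAnchor Nf) : ¬ WithoutPin := by
  obtain ⟨Nf, hNf, reg, mc, hc, hms, has, hbr, Mh, hMh, ε, hε, hgap⟩ := H
  intro h
  have hchi := h Nf hNf ({ reg with mcrit := fun k => reg.mcrit k + reg.a k * Mh / reg.Zm k } :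
      QCDRegularisation Nf) mc hc hms has (by
    filter_upwards [hbr] with k hk
    have : 0 ≤ reg.a k * Mh / reg.Zm k := div_nonneg (mul_nonneg (reg.a_pos k).le hMh) (reg.Zm_pos k).le
    show (-1 : ℝ) < reg.mcrit k + reg.a k * Mh / reg.Zm k
    linarith)
  exact RobustYangMillsHandover.Negative.not_isChiralAtZero_mcrit_shift_of_uniformGapAbove reg Mh hε hgap hchi

/-! ### The CORNER is load-bearing -/

/-- The crux with the CORNER dropped (a pin to an arbitrary sequence `mc`). -/
def WithoutCorner : Prop :=
  ∀ Nf : ℕ, Nf = 2 ∨ Nf = 3 → ∀ (reg : QCDRegularisation Nf) (mc : ℕ → ℝ),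
    Pin reg mc → reg.HasMassScaling → AS reg → Branch reg → reg.IsChiralAtZero

/-- **H_reg** (weaker than H_anchor: no corner needed): a mass-scaling, asymptotically scaling regularisation on the
physical branch, uniformly gapped above a threshold. -/
def GappedScalingReg (Nf : ℕ) : Prop :=
  ∃ reg : QCDRegularisation Nf, reg.HasMassScaling ∧ AS reg ∧ Branch reg ∧
    ∃ Mh : ℝ, 0 ≤ Mh ∧ ∃ ε > (0 : ℝ), ∀ m : Fin Nf → ℝ, (∀ f, Mh < m f) → (reg.scheme m 0 0).HasLatticeMassGap ε

/-- H_anchor gives H_reg. [folklore] -/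
theorem gappedScalingReg_of_gappedAnchor (h : GappedAnchor Nf) : GappedScalingReg Nf := by
  obtain ⟨reg, -, -, hms, has, hbr, rest⟩ := h
  exact ⟨reg, hms, has, hbr, rest⟩

/-- **Dropping the CORNER is fatal (modulo H_reg)**: pin the shifted regularisation to ITS OWN critical mass
(`mc := m_crit'`, pin ≡ 0). The pin is only as good as the set it pins to. [folklore] -/
theorem withoutCorner_false_of_gappedScalingReg (H : ∃ Nf : ℕ, (Nf = 2 ∨ Nf = 3) ∧ GappedScalingReg Nf) :
    ¬ WithoutCorner := by
  obtain ⟨Nf, hNf, reg, hms, has, hbr, Mh, hMh, ε, hε, hgap⟩ := H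
  intro h
  set reg' : QCDRegularisation Nf := { reg with mcrit := fun k => reg.mcrit k + reg.a k * Mh / reg.Zm k } with hreg'
  have hpin : Pin reg' reg'.mcrit := by
    simp only [Pin, sub_self, zero_mul, zero_div]
    exact tendsto_const_nhds
  have hchi := h Nf hNf reg' reg'.mcrit hpin hms has (by
    filter_upwards [hbr] with k hk
    have : 0 ≤ reg.a k * Mh / reg.Zm k := div_nonneg (mul_nonneg (reg.a_pos k).le hMh) (reg.Zm_pos k).le
    show (-1 : ℝ) < reg.mcrit k + reg.a k * Mh / reg.Zm k
    linarith)
  exact RobustYangMillsHandover.Negative.not_isChiralAtZero_mcrit_shift_of_uniformGapAbove reg Mh hε hgap hchi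

/-! ### MASS SCALING is load-bearing -/

/-- The crux with `HasMassScaling` dropped. -/
def WithoutMassScaling : Prop :=
  ∀ Nf : ℕ, Nf = 2 ∨ Nf = 3 → ∀ (reg : QCDRegularisation Nf) (mc : ℕ → ℝ),
    Corner reg mc → Pin reg mc → AS reg → Branch reg → reg.IsChiralAtZero

/-- **H_tuple**: an HONESTLY PINNED regularisation (all five crux hypotheses) whose heavy region `μ_f ≥ M_h` is gapped
at ONE rate with constants uniform in the (possibly `k`-dependent) renormalised tuple `μ` — the bare-parameter form of
"heavier is more gapped, amplitudes bounded".  Not constructible in the tree. -/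
def TupleUniformGap (Nf : ℕ) : Prop :=
  ∃ (reg : QCDRegularisation Nf) (mc : ℕ → ℝ), Corner reg mc ∧ Pin reg mc ∧ reg.HasMassScaling ∧ AS reg ∧
    Branch reg ∧ ∃ Mh ε : ℝ, 0 < ε ∧
      ∀ (R R' : ℕ) (A : QCDLatticeObservable Nf R) (B : QCDLatticeObservable Nf R'), ∃ C : ℝ, ∀ᶠ k in atTop,
        ∀ μ : Fin Nf → ℝ, (∀ f, Mh ≤ μ f) → ∀ S : ℕ, reg.L k ≤ S → ∀ n : ℕ, n ≤ S →
          ‖qcdLatticeConnectedCorr (reg.β k) (2 * S + 1) (fun f => reg.mcrit k + reg.a k * μ f / reg.Zm k) A B n‖ ≤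
            C * Real.exp (-(ε * (reg.a k * n)))

/-- **Dropping `HasMassScaling` is fatal (modulo H_tuple)**: divide `Z_m` by `k + 1`.  The corner (same `β`), the
branch (same `m_crit`) and asymptotic scaling (same `β, a`) are untouched; the pin is MULTIPLIED by `1/(k+1)` and
survives; but the positive tuple `m` is now realised by the bare masses of the renormalised tuple `(k+1)·m → ∞`, which
is eventually heavy, so every positive tuple carries the rate `ε`: not chiral at zero.  (The witness violates mass
scaling, as it must if the crux is true: `Z_m/(k+1)/log^γ → 0`.)  Any proof must use `HasMassScaling` — it is what
keeps `∀ m > 0` an honest light-quark family. [folklore] -/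
theorem withoutMassScaling_false_of_tupleUniformGap (H : ∃ Nf : ℕ, (Nf = 2 ∨ Nf = 3) ∧ TupleUniformGap Nf) :
    ¬ WithoutMassScaling := by
  obtain ⟨Nf, hNf, reg, mc, hc, hp, -, has, hbr, Mh, ε, hε, hgap⟩ := H
  intro h
  set reg' : QCDRegularisation Nf :=
    { reg with Zm := fun k => reg.Zm k / ((k : ℝ) + 1)
               Zm_pos := fun k => div_pos (reg.Zm_pos k) (by positivity) } with hreg'
  -- the pin survives: it is the old pin times `1/(k+1)`
  have hpin : Pin reg' mc := by
    have h1 : Tendsto (fun k : ℕ => 1 / ((k : ℝ) + 1)) atTop (nhds 0) := tendsto_one_div_add_atTop_nhds_zero_nat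
    have h2 := hp.mul h1
    rw [mul_zero] at h2
    refine h2.congr' (Eventually.of_forall fun k => ?_)
    show (reg.mcrit k - mc k) * reg.Zm k / reg.a k * (1 / ((k : ℝ) + 1)) =
      (reg.mcrit k - mc k) * (reg.Zm k / ((k : ℝ) + 1)) / reg.a k
    ring
  have hchi : reg'.IsChiralAtZero := h Nf hNf reg' mc hc hpin has hbr
  -- every positive tuple of `reg'` carries the rate `ε`
  refine RobustYangMillsHandover.Negative.not_isChiralAtZero_of_uniformLatticeGap reg' hε (fun m hm => ?_) hchi
  intro R R' A B
  obtain ⟨C, hC⟩ := hgap R R' A B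
  refine ⟨C, ?_⟩
  have hheavy : ∀ᶠ k : ℕ in atTop, ∀ f : Fin Nf, Mh ≤ ((k : ℝ) + 1) * m f := by
    refine eventually_all.2 fun f => ?_
    have ht : Tendsto (fun k : ℕ => ((k : ℝ) + 1) * m f) atTop atTop :=
      (tendsto_natCast_atTop_atTop.atTop_add tendsto_const_nhds).atTop_mul_const (hm f)
    exact ht.eventually_ge_atTop Mh
  filter_upwards [hC, hheavy] with k hk hh S hS n hn
  have hmq : (fun fl => (reg'.scheme m 0 0).mq fl k) = fun f => reg.mcrit k + reg.a k * (((k : ℝ) + 1) * m f) / reg.Zm k := by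
    funext f
    show reg.mcrit k + reg.a k * m f / (reg.Zm k / ((k : ℝ) + 1)) = _
    have hZ : reg.Zm k ≠ 0 := (reg.Zm_pos k).ne'
    have hk1 : ((k : ℝ) + 1) ≠ 0 := by positivity
    field_simp
  have := hk (fun f => ((k : ℝ) + 1) * m f) hh S hS n hn
  rw [hmq]
  exact this

/-! ### ASYMPTOTIC SCALING is load-bearing -/

/-- The crux with asymptotic scaling dropped. -/
def WithoutAsymptoticScaling : Prop :=
  ∀ Nf : ℕ, Nf = 2 ∨ Nf = 3 → ∀ (reg : QCDRegularisation Nf) (mc : ℕ → ℝ),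
    Corner reg mc → Pin reg mc → reg.HasMassScaling → Branch reg → reg.IsChiralAtZero

/-- **H_const**: at some FIXED coupling `β*` the non-massive degenerate bare masses have a least upper bound
`μ* > −1`, and a mass-scaling regularisation with `β_k ≡ β*` parked EXACTLY at `m_crit ≡ μ*` is uniformly gapped in its
own units `a_k → 0` (physically: approaching `κ_c(β*)` from the massive side at bare offset `a_k m/Z_m(k)`, the lattice
correlation length grows at most like `(a_k m/Z_m)^{-1/2}` (Aoki scenario, GMOR at fixed `β`) or stays bounded
(first-order scenario), so the rate in units of `a_k` diverges).  Not constructible in the tree. -/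
def HardConstantCouplingCorner (Nf : ℕ) : Prop :=
  ∃ (reg : QCDRegularisation Nf) (β₀ μ₀ : ℝ), (∀ k, reg.β k = β₀) ∧ (∀ k, reg.mcrit k = μ₀) ∧
    IsLUB {μ : ℝ | ¬ (∀ (R R' : ℕ) (A : QCDLatticeObservable Nf R) (B : QCDLatticeObservable Nf R'),
      ∃ (C δ : ℝ) (S₀ : ℕ), 0 < δ ∧ ∀ S : ℕ, S₀ ≤ S → ∀ n : ℕ, n ≤ S →
        ‖qcdLatticeConnectedCorr β₀ (2 * S + 1) (fun _ : Fin Nf => μ) A B n‖ ≤ C * Real.exp (-(δ * n)))} μ₀ ∧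
    (-1 : ℝ) < μ₀ ∧ reg.HasMassScaling ∧ ∃ ε > (0 : ℝ), UniformGap reg ε

/-- **Dropping asymptotic scaling is fatal (modulo H_const)**: the constant-coupling regularisation of H_const carries
the corner (constantly), the pin (≡ 0), mass scaling and the branch, and is not chiral at zero.  Asymptotic scaling
is what makes `a_k` the lattice spacing of the asymptotically free theory rather than a label. [folklore] -/
theorem withoutAsymptoticScaling_false_of_hardConstantCouplingCorner
    (H : ∃ Nf : ℕ, (Nf = 2 ∨ Nf = 3) ∧ HardConstantCouplingCorner Nf) : ¬ WithoutAsymptoticScaling := by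
  obtain ⟨Nf, hNf, reg, β₀, μ₀, hβ, hcrit, hlub, hμ₀, hms, ε, hε, hgap⟩ := H
  intro h
  have hc : Corner reg (fun _ => μ₀) := Eventually.of_forall fun k => by rw [hβ k]; exact hlub
  have hp : Pin reg (fun _ => μ₀) := by
    refine (tendsto_const_nhds (x := (0 : ℝ))).congr' (Eventually.of_forall fun k => ?_)
    simp [hcrit k]
  have hbr : Branch reg := Eventually.of_forall fun k => by rw [hcrit k]; exact hμ₀
  exact RobustYangMillsHandover.Negative.not_isChiralAtZero_of_uniformLatticeGap reg hε hgap
    (h Nf hNf reg _ hc hp hms hbr)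

/-! ### The BRANCH hypothesis is redundant modulo "the corner stays above `−1 + η`" -/

/-- The crux with the branch hypothesis dropped. -/
def WithoutBranch : Prop :=
  ∀ Nf : ℕ, Nf = 2 ∨ Nf = 3 → ∀ (reg : QCDRegularisation Nf) (mc : ℕ → ℝ),
    Corner reg mc → Pin reg mc → reg.HasMassScaling → AS reg → reg.IsChiralAtZero

/-- **Corner + pin + mass scaling put `m_crit` within `o(1)` of the corner**: `m_crit k − mc k → 0`
(`= pin_k · a_k/Z_m(k)`, and `a_k/Z_m(k) → 0` for `N_f = 2,3` by the landed `HonestHeavyAnchorSplit.tendsto_a_div_Zm`).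
[folklore] -/
theorem tendsto_mcrit_sub_corner (hNf : Nf = 2 ∨ Nf = 3) (reg : QCDRegularisation Nf) (mc : ℕ → ℝ)
    (hp : Pin reg mc) (hms : reg.HasMassScaling) : Tendsto (fun k => reg.mcrit k - mc k) atTop (nhds 0) := by
  have h1 := HonestHeavyAnchorSplit.tendsto_a_div_Zm reg hms (HonestHeavyAnchorSplit.massExponent_nonneg hNf)
  have h2 := hp.mul h1
  rw [mul_zero] at h2
  refine h2.congr' (Eventually.of_forall fun k => ?_)
  have ha : reg.a k ≠ 0 := (reg.a_pos k).ne'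
  have hZ : reg.Zm k ≠ 0 := (reg.Zm_pos k).ne'
  field_simp

/-- **The branch is implied** by pin + mass scaling once the corner stays eventually above `−1 + η` for some `η > 0`
(for `N_f = 2, 3`). [folklore] -/
theorem branch_of_corner_pin_massScaling (hNf : Nf = 2 ∨ Nf = 3) (reg : QCDRegularisation Nf) (mc : ℕ → ℝ)
    (hp : Pin reg mc) (hms : reg.HasMassScaling) {η : ℝ} (hη : 0 < η) (hmc : ∀ᶠ k in atTop, -1 + η ≤ mc k) :
    Branch reg := by
  have h := tendsto_mcrit_sub_corner hNf reg mc hp hms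
  have hε : ∀ᶠ k in atTop, -(η / 2) < reg.mcrit k - mc k :=
    h.eventually (eventually_gt_nhds (by linarith))
  filter_upwards [hε, hmc] with k h1 h2
  linarith

/-- **H_above**: along every asymptotically scaling regularisation, a corner (if it exists eventually) stays above
`−1 + η` (physically `μ_c(β) → 0⁻` as `β → ∞`; the doublers' critical points sit at `−2, −4, −6, −8`). -/
def CornersAboveMinusOne : Prop :=
  ∀ Nf : ℕ, Nf = 2 ∨ Nf = 3 → ∀ (reg : QCDRegularisation Nf) (mc : ℕ → ℝ), Corner reg mc → AS reg →
    ∃ η > (0 : ℝ), ∀ᶠ k in atTop, -1 + η ≤ mc k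

/-- **Modulo H_above the branch hypothesis is decoration**: the crux is equivalent to its branch-free form.
Information for the prover: `∀ᶠ k, −1 < m_crit k` is never needed for TRUTH, only as the Lüscher positivity range
(`κ < 1/6`) in transfer-matrix PROOFS. [folklore] -/
theorem chiralCornerSoftness_iff_withoutBranch (H : CornersAboveMinusOne) : ChiralCornerSoftness ↔ WithoutBranch := by
  rw [← crux_iff]
  constructor
  · intro h Nf hNf reg mc hc hp hms has
    obtain ⟨η, hη, hmc⟩ := H Nf hNf reg mc hc has
    exact h Nf hNf reg mc hc hp hms has (branch_of_corner_pin_massScaling hNf reg mc hp hms hη hmc)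
  · intro h Nf hNf reg mc hc hp hms has _
    exact h Nf hNf reg mc hc hp hms has

/-! ## §3 Closed junk escapes (records; the `N_f = 0` slice is landed as `RayDescentNegative.corner_unsat_zero`) -/

/-- The `N_f = 0` slice of the corner clause is unsatisfiable (so the `N_f ∈ {2,3}` guard is idle there; it bites at
`N_f = 1`). [folklore] -/
theorem corner_zero_unsat (reg : QCDRegularisation 0) (mc : ℕ → ℝ) : ¬ Corner reg mc :=
  RayDescentNegative.not_eventually_corner_zero reg mc

/-- Unit relabelings open no loophole: `(a, Z_m) ↦ (c a, c Z_m)` fixes every bare trajectory and the pin and maps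
`UniformGap reg' ε ↔ UniformGap reg (c ε)` (landed `RayDescentNegative.gap_iff_of_rescaled`), so `∃ ε > 0, UniformGap`
— hence `IsChiralAtZero` — is invariant. [folklore] -/
theorem uniformGap_rescale (reg reg' : QCDRegularisation Nf) {c : ℝ} (hc : 0 < c)
    (ha : ∀ k, reg'.a k = c * reg.a k) (hZ : ∀ k, reg'.Zm k = c * reg.Zm k) (hcrit : ∀ k, reg'.mcrit k = reg.mcrit k)
    (hβ : ∀ k, reg'.β k = reg.β k) (hL : ∀ k, reg'.L k = reg.L k) :
    (∃ ε > (0 : ℝ), UniformGap reg' ε) ↔ ∃ ε > (0 : ℝ), UniformGap reg ε := by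
  constructor
  · rintro ⟨ε, hε, h⟩
    exact ⟨c * ε, by positivity, fun m hm =>
      (RayDescentNegative.gap_iff_of_rescaled reg reg' c ha hZ hcrit hc.ne' hβ hL m ε).mp (h m hm)⟩
  · rintro ⟨ε, hε, h⟩
    refine ⟨ε / c, by positivity, fun m hm => ?_⟩
    rw [RayDescentNegative.gap_iff_of_rescaled reg reg' c ha hZ hcrit hc.ne' hβ hL m (ε / c)]
    rw [mul_div_cancel₀ _ hc.ne']
    exact h m hm

end Summit.QuantumFields.QCD.Theorems.ChiralCornerSoftness.Negative

end
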